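import Mathlib
import HarnessLib

/-!
# Positive unimodular refinement around an irrational ray (lens 5, part 1)

Port of `Cruxes/DescentPerfectToAll/Lens5_UnimodularRefinement.lean` (author: res-B-lens-5 g9/g10).
Part 1: Core potential lemmas and main refinement theorems.

OURS · counted 0.  Nothing here proves resolution in characteristic `p`; no crux or stub is proved here.
Pure lattice combinatorics, Mathlib-only, def-free.

## Main results

- `exists_unimodular_positive_refinement`: Positive unimodular refinement around an irrational ray (positive quadrant).
- `exists_unimodular_positive_refinement'`: Positive unimodular refinement around an irrational ray (any quadrant).

Resolution of singularities in positive characteristic is NOT proved.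
-/

noncomputable section

set_option linter.dupNamespace false

namespace Summit.ResolutionOfSingularities.ResolutionOfSingularities.Theorems.RadicialJung.CleanModels.Lens5.UnimodularRefinement

/-! ## Per-functional potential: step I (`λ ↦ (λ₁, λ₁ + λ₂)`, when `β < α`) -/

/-- Step I potential bound: the potential never increases. -/
theorem termI_le (α β : ℝ) (hβ : 0 < β) (hβα : β < α) (x y x' : ℤ) (hx' : x' = x + y)
    (h : 0 < (x : ℝ) * α + y * β) :
    (if 0 < x ∧ 0 < x' then 0 else x.natAbs + x'.natAbs + 1) ≤
      (if 0 < x ∧ 0 < y then 0 else x.natAbs + y.natAbs + 1) := by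
  subst hx'
  by_cases hg : 0 < x ∧ 0 < y
  · have hg' : 0 < x ∧ 0 < x + y := ⟨hg.1, by omega⟩
    rw [if_pos hg', if_pos hg]
  · rw [if_neg hg]
    by_cases hg' : 0 < x ∧ 0 < x + y
    · rw [if_pos hg']; exact Nat.zero_le _
    · rw [if_neg hg']
      rcases le_or_gt x 0 with hx | hx
      · have hxy : 0 < x + y := by
          by_contra hcon
          have hcon' : ((x : ℝ) + y) ≤ 0 := by exact_mod_cast (not_lt.mp hcon)
          have hx0 : (x : ℝ) ≤ 0 := by exact_mod_cast hx
          nlinarith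
        omega
      · omega

/-- Step I potential strict decrease when not good and `x ≠ 0`. -/
theorem termI_lt (α β : ℝ) (hβ : 0 < β) (hβα : β < α) (x y x' : ℤ) (hx' : x' = x + y)
    (h : 0 < (x : ℝ) * α + y * β) (hng : ¬ (0 < x ∧ 0 < y)) (hx0 : x ≠ 0) :
    (if 0 < x ∧ 0 < x' then 0 else x.natAbs + x'.natAbs + 1) <
      (if 0 < x ∧ 0 < y then 0 else x.natAbs + y.natAbs + 1) := by
  subst hx'
  rw [if_neg hng]
  by_cases hg' : 0 < x ∧ 0 < x + y
  · rw [if_pos hg']; omega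
  · rw [if_neg hg']
    rcases le_or_gt x 0 with hx | hx
    · have hxy : 0 < x + y := by
        by_contra hcon
        have hcon' : ((x : ℝ) + y) ≤ 0 := by exact_mod_cast (not_lt.mp hcon)
        have hx0' : (x : ℝ) ≤ 0 := by exact_mod_cast hx
        nlinarith
      omega
    · omega

/-! ## Per-functional potential: step II (`λ ↦ (λ₁ + λ₂, λ₂)`, when `α < β`) -/

/-- Step II potential bound: the potential never increases. -/
theorem termII_le (α β : ℝ) (hα : 0 < α) (hαβ : α < β) (x y y' : ℤ) (hy' : y' = x + y)
    (h : 0 < (x : ℝ) * α + y * β) :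
    (if 0 < y' ∧ 0 < y then 0 else y'.natAbs + y.natAbs + 1) ≤
      (if 0 < x ∧ 0 < y then 0 else x.natAbs + y.natAbs + 1) := by
  subst hy'
  by_cases hg : 0 < x ∧ 0 < y
  · have hg' : 0 < x + y ∧ 0 < y := ⟨by omega, hg.2⟩
    rw [if_pos hg', if_pos hg]
  · rw [if_neg hg]
    by_cases hg' : 0 < x + y ∧ 0 < y
    · rw [if_pos hg']; exact Nat.zero_le _
    · rw [if_neg hg']
      rcases le_or_gt y 0 with hy | hy
      · have hxy : 0 < x + y := by
          by_contra hcon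
          have hcon' : ((x : ℝ) + y) ≤ 0 := by exact_mod_cast (not_lt.mp hcon)
          have hy0 : (y : ℝ) ≤ 0 := by exact_mod_cast hy
          nlinarith
        omega
      · omega

/-- Step II potential strict decrease when not good and `y ≠ 0`. -/
theorem termII_lt (α β : ℝ) (hα : 0 < α) (hαβ : α < β) (x y y' : ℤ) (hy' : y' = x + y)
    (h : 0 < (x : ℝ) * α + y * β) (hng : ¬ (0 < x ∧ 0 < y)) (hy0 : y ≠ 0) :
    (if 0 < y' ∧ 0 < y then 0 else y'.natAbs + y.natAbs + 1) <
      (if 0 < x ∧ 0 < y then 0 else x.natAbs + y.natAbs + 1) := by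
  subst hy'
  rw [if_neg hng]
  by_cases hg' : 0 < x + y ∧ 0 < y
  · rw [if_pos hg']; omega
  · rw [if_neg hg']
    rcases le_or_gt y 0 with hy | hy
    · have hxy : 0 < x + y := by
        by_contra hcon
        have hcon' : ((x : ℝ) + y) ≤ 0 := by exact_mod_cast (not_lt.mp hcon)
        have hy0' : (y : ℝ) ≤ 0 := by exact_mod_cast hy
        nlinarith
      omega
    · omega

/-! ## The invariant forces `α ≠ β` -/

/-- The unimodular invariant and independence force `α ≠ β`. -/
theorem ne_of_state (ω₁ ω₂ : ℝ) (hind : ∀ u v : ℤ, (u : ℝ) * ω₁ + v * ω₂ = 0 → u = 0 ∧ v = 0)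
    (α β : ℝ) (a b c d : ℤ) (ha : 0 ≤ a) (hb : 0 ≤ b) (hc : 0 ≤ c) (hd : 0 ≤ d)
    (hdet : a * d - b * c = 1 ∨ a * d - b * c = -1) (h1 : ω₁ = a * α + b * β) (h2 : ω₂ = c * α + d * β) :
    α ≠ β := by
  intro hαβ
  have e : ((c + d : ℤ) : ℝ) * ω₁ + ((-(a + b) : ℤ) : ℝ) * ω₂ = 0 := by
    rw [h1, h2, hαβ]; push_cast; ring
  obtain ⟨hcd, hab⟩ := hind _ _ e
  have h0 : a = 0 ∧ b = 0 ∧ c = 0 ∧ d = 0 := by omega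
  obtain ⟨rfl, rfl, rfl, rfl⟩ := h0
  simp at hdet

/-! ## The double induction -/

/-- From any state (positive basis `(a,c),(b,d)`, `ω = α(a,c) + β(b,d)`, `α, β > 0`) whose potential is `≤ M` and whose run-length
bound `⌊α/β⌋ + ⌊β/α⌋` is `≤ R`, a good state is reachable. -/
theorem refine_aux (ω₁ ω₂ : ℝ) (hind : ∀ u v : ℤ, (u : ℝ) * ω₁ + v * ω₂ = 0 → u = 0 ∧ v = 0)
    (F : Finset (ℤ × ℤ)) (hF : ∀ f ∈ F, 0 < (f.1 : ℝ) * ω₁ + f.2 * ω₂) :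
    ∀ (M R : ℕ) (α β : ℝ) (a b c d : ℤ), 0 < α → 0 < β → 0 ≤ a → 0 ≤ b → 0 ≤ c → 0 ≤ d →
      (a * d - b * c = 1 ∨ a * d - b * c = -1) → ω₁ = a * α + b * β → ω₂ = c * α + d * β →
      (∑ f ∈ F, (if 0 < f.1 * a + f.2 * c ∧ 0 < f.1 * b + f.2 * d then 0
          else (f.1 * a + f.2 * c).natAbs + (f.1 * b + f.2 * d).natAbs + 1)) ≤ M →
      ⌊α / β⌋₊ + ⌊β / α⌋₊ ≤ R →
      ∃ (a' b' c' d' : ℤ) (α' β' : ℝ), 0 < α' ∧ 0 < β' ∧ 0 ≤ a' ∧ 0 ≤ b' ∧ 0 ≤ c' ∧ 0 ≤ d' ∧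
        (a' * d' - b' * c' = 1 ∨ a' * d' - b' * c' = -1) ∧ ω₁ = a' * α' + b' * β' ∧ ω₂ = c' * α' + d' * β' ∧
        ∀ f ∈ F, 0 < f.1 * a' + f.2 * c' ∧ 0 < f.1 * b' + f.2 * d' := by
  -- the value of `f` is conserved: `λ₁ α + λ₂ β = f(ω)`
  have hval : ∀ (α β : ℝ) (a b c d : ℤ), ω₁ = a * α + b * β → ω₂ = c * α + d * β →
      ∀ f ∈ F, 0 < ((f.1 * a + f.2 * c : ℤ) : ℝ) * α + ((f.1 * b + f.2 * d : ℤ) : ℝ) * β := by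
    intro α β a b c d h1 h2 f hf
    have := hF f hf
    rw [h1, h2] at this
    push_cast
    nlinarith [this]
  intro M
  induction M with
  | zero =>
    intro R α β a b c d hα hβ ha hb hc hd hdet h1 h2 hMes hR
    refine ⟨a, b, c, d, α, β, hα, hβ, ha, hb, hc, hd, hdet, h1, h2, ?_⟩
    intro f hf
    have h0 := (Finset.sum_eq_zero_iff.mp (Nat.le_zero.mp hMes)) f hf
    by_contra hng
    rw [if_neg hng] at h0
    omega
  | succ M ihM =>
    intro R
    induction R with
    | zero =>
      intro α β a b c d hα hβ ha hb hc hd hdet h1 h2 hMes hR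
      exfalso
      have hf1 : ⌊α / β⌋₊ = 0 := by omega
      have hf2 : ⌊β / α⌋₊ = 0 := by omega
      rw [Nat.floor_eq_zero, div_lt_one hβ] at hf1
      rw [Nat.floor_eq_zero, div_lt_one hα] at hf2
      exact lt_asymm hf1 hf2
    | succ R ihR =>
      intro α β a b c d hα hβ ha hb hc hd hdet h1 h2 hMes hR
      by_cases hall : ∀ f ∈ F, 0 < f.1 * a + f.2 * c ∧ 0 < f.1 * b + f.2 * d
      · exact ⟨a, b, c, d, α, β, hα, hβ, ha, hb, hc, hd, hdet, h1, h2, hall⟩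
      have hne : α ≠ β := ne_of_state ω₁ ω₂ hind α β a b c d ha hb hc hd hdet h1 h2
      have hvf := hval α β a b c d h1 h2
      rcases lt_or_gt_of_ne hne with hlt | hgt
      · ------------------------------------------------------------------ step II: (α, β − α, a + b, b, c + d, d)
        have hβ' : 0 < β - α := sub_pos.mpr hlt
        have hdet' : (a + b) * d - b * (c + d) = 1 ∨ (a + b) * d - b * (c + d) = -1 := by
          have e : (a + b) * d - b * (c + d) = a * d - b * c := by ring
          rw [e]; exact hdet
        have h1' : ω₁ = ((a + b : ℤ) : ℝ) * α + b * (β - α) := by rw [h1]; push_cast; ring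
        have h2' : ω₂ = ((c + d : ℤ) : ℝ) * α + d * (β - α) := by rw [h2]; push_cast; ring
        have hle : (∑ f ∈ F, (if 0 < f.1 * (a + b) + f.2 * (c + d) ∧ 0 < f.1 * b + f.2 * d then 0
            else (f.1 * (a + b) + f.2 * (c + d)).natAbs + (f.1 * b + f.2 * d).natAbs + 1)) ≤
            (∑ f ∈ F, (if 0 < f.1 * a + f.2 * c ∧ 0 < f.1 * b + f.2 * d then 0
            else (f.1 * a + f.2 * c).natAbs + (f.1 * b + f.2 * d).natAbs + 1)) :=
          Finset.sum_le_sum fun f hf =>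
            termII_le α β hα hlt _ _ _ (by ring) (hvf f hf)
        rcases hle.lt_or_eq with hlt2 | heq2
        · -- potential dropped: outer induction hypothesis
          exact ihM _ α (β - α) (a + b) b (c + d) d hα hβ' (by omega) hb (by omega) hd hdet' h1' h2'
            (by omega) le_rfl
        · -- potential unchanged: every non-good `f` waits with `λ₂ = 0`
          have hwait : ∀ f ∈ F, ¬ (0 < f.1 * a + f.2 * c ∧ 0 < f.1 * b + f.2 * d) → f.1 * b + f.2 * d = 0 := by
            intro f hf hng
            by_contra hy0
            have hlt3 := Finset.sum_lt_sum
              (fun f hf => termII_le α β hα hlt (f.1 * a + f.2 * c) (f.1 * b + f.2 * d)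
                (f.1 * (a + b) + f.2 * (c + d)) (by ring) (hvf f hf))
              ⟨f, hf, termII_lt α β hα hlt (f.1 * a + f.2 * c) (f.1 * b + f.2 * d)
                (f.1 * (a + b) + f.2 * (c + d)) (by ring) (hvf f hf) hng hy0⟩
            exact absurd heq2 (ne_of_lt hlt3)
          have hne' : α ≠ β - α :=
            ne_of_state ω₁ ω₂ hind α (β - α) (a + b) b (c + d) d (by omega) hb (by omega) hd hdet' h1' h2'
          rcases lt_or_gt_of_ne hne' with hlt4 | hgt4
          · -- next step is again of type II: inner induction hypothesis (run-length bound drops)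
            refine ihR α (β - α) (a + b) b (c + d) d hα hβ' (by omega) hb (by omega) hd hdet' h1' h2'
              (heq2 ▸ hMes) ?_
            have hq1 : ⌊α / (β - α)⌋₊ = 0 := by
              rw [Nat.floor_eq_zero, div_lt_one hβ']; exact hlt4
            have hq2 : ⌊(β - α) / α⌋₊ = ⌊β / α⌋₊ - 1 := by
              rw [sub_div, div_self hα.ne', Nat.floor_sub_one]
            have hq3 : ⌊α / β⌋₊ = 0 := by
              rw [Nat.floor_eq_zero, div_lt_one hβ]; exact hlt
            omega
          · -- next step is of type I: after it every `f` is good: final state (2α − β, β − α, a + b, a + 2b, c + d, c + 2d)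
            have hα'' : 0 < α - (β - α) := sub_pos.mpr hgt4
            refine ⟨a + b, (a + b) + b, c + d, (c + d) + d, α - (β - α), β - α, hα'', hβ', by omega, by omega,
              by omega, by omega, ?_, ?_, ?_, ?_⟩
            · have e : (a + b) * (c + d + d) - (a + b + b) * (c + d) = a * d - b * c := by ring
              rw [e]; exact hdet
            · rw [h1]; push_cast; ring
            · rw [h2]; push_cast; ring
            · intro f hf
              by_cases hg : 0 < f.1 * a + f.2 * c ∧ 0 < f.1 * b + f.2 * d
              · constructor <;> nlinarith [hg.1, hg.2]
              · have hy0 := hwait f hf hg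
                have hx : 0 < f.1 * a + f.2 * c := by
                  have := hvf f hf
                  have hy0' : ((f.1 * b + f.2 * d : ℤ) : ℝ) = 0 := by exact_mod_cast hy0
                  rw [hy0', zero_mul, add_zero] at this
                  have hx' : (0 : ℝ) < ((f.1 * a + f.2 * c : ℤ) : ℝ) := (pos_iff_pos_of_mul_pos this).mpr hα
                  exact_mod_cast hx'
                constructor <;> nlinarith [hx, hy0]
      · ------------------------------------------------------------------ step I: (α − β, β, a, a + b, c, c + d)
        have hα' : 0 < α - β := sub_pos.mpr hgt
        have hdet' : a * (c + d) - (a + b) * c = 1 ∨ a * (c + d) - (a + b) * c = -1 := by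
          have e : a * (c + d) - (a + b) * c = a * d - b * c := by ring
          rw [e]; exact hdet
        have h1' : ω₁ = (a : ℝ) * (α - β) + ((a + b : ℤ) : ℝ) * β := by rw [h1]; push_cast; ring
        have h2' : ω₂ = (c : ℝ) * (α - β) + ((c + d : ℤ) : ℝ) * β := by rw [h2]; push_cast; ring
        have hle : (∑ f ∈ F, (if 0 < f.1 * a + f.2 * c ∧ 0 < f.1 * (a + b) + f.2 * (c + d) then 0
            else (f.1 * a + f.2 * c).natAbs + (f.1 * (a + b) + f.2 * (c + d)).natAbs + 1)) ≤
            (∑ f ∈ F, (if 0 < f.1 * a + f.2 * c ∧ 0 < f.1 * b + f.2 * d then 0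
            else (f.1 * a + f.2 * c).natAbs + (f.1 * b + f.2 * d).natAbs + 1)) :=
          Finset.sum_le_sum fun f hf =>
            termI_le α β hβ hgt _ _ _ (by ring) (hvf f hf)
        rcases hle.lt_or_eq with hlt2 | heq2
        · -- potential dropped: outer induction hypothesis
          exact ihM _ (α - β) β a (a + b) c (c + d) hα' hβ ha (by omega) hc (by omega) hdet' h1' h2'
            (by omega) le_rfl
        · -- potential unchanged: every non-good `f` waits with `λ₁ = 0`
          have hwait : ∀ f ∈ F, ¬ (0 < f.1 * a + f.2 * c ∧ 0 < f.1 * b + f.2 * d) → f.1 * a + f.2 * c = 0 := by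
            intro f hf hng
            by_contra hx0
            have hlt3 := Finset.sum_lt_sum
              (fun f hf => termI_le α β hβ hgt (f.1 * a + f.2 * c) (f.1 * b + f.2 * d)
                (f.1 * (a + b) + f.2 * (c + d)) (by ring) (hvf f hf))
              ⟨f, hf, termI_lt α β hβ hgt (f.1 * a + f.2 * c) (f.1 * b + f.2 * d)
                (f.1 * (a + b) + f.2 * (c + d)) (by ring) (hvf f hf) hng hx0⟩
            exact absurd heq2 (ne_of_lt hlt3)
          have hne' : α - β ≠ β :=
            ne_of_state ω₁ ω₂ hind (α - β) β a (a + b) c (c + d) ha (by omega) hc (by omega) hdet' h1' h2'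
          rcases lt_or_gt_of_ne hne' with hlt4 | hgt4
          · -- next step is of type II: after it every `f` is good: final state (α − β, 2β − α, 2a + b, a + b, 2c + d, c + d)
            have hβ'' : 0 < β - (α - β) := sub_pos.mpr hlt4
            refine ⟨a + (a + b), a + b, c + (c + d), c + d, α - β, β - (α - β), hα', hβ'', by omega, by omega,
              by omega, by omega, ?_, ?_, ?_, ?_⟩
            · have e : (a + (a + b)) * (c + d) - (a + b) * (c + (c + d)) = a * d - b * c := by ring
              rw [e]; exact hdet
            · rw [h1]; push_cast; ring
            · rw [h2]; push_cast; ring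
            · intro f hf
              by_cases hg : 0 < f.1 * a + f.2 * c ∧ 0 < f.1 * b + f.2 * d
              · constructor <;> nlinarith [hg.1, hg.2]
              · have hx0 := hwait f hf hg
                have hy : 0 < f.1 * b + f.2 * d := by
                  have := hvf f hf
                  have hx0' : ((f.1 * a + f.2 * c : ℤ) : ℝ) = 0 := by exact_mod_cast hx0
                  rw [hx0', zero_mul, zero_add] at this
                  have hy' : (0 : ℝ) < ((f.1 * b + f.2 * d : ℤ) : ℝ) := (pos_iff_pos_of_mul_pos this).mpr hβ
                  exact_mod_cast hy'
                constructor <;> nlinarith [hy, hx0]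
          · -- next step is again of type I: inner induction hypothesis (run-length bound drops)
            refine ihR (α - β) β a (a + b) c (c + d) hα' hβ ha (by omega) hc (by omega) hdet' h1' h2'
              (heq2 ▸ hMes) ?_
            have hq1 : ⌊β / (α - β)⌋₊ = 0 := by
              rw [Nat.floor_eq_zero, div_lt_one hα']; exact hgt4
            have hq2 : ⌊(α - β) / β⌋₊ = ⌊α / β⌋₊ - 1 := by
              rw [sub_div, div_self hβ.ne', Nat.floor_sub_one]
            have hq3 : ⌊β / α⌋₊ = 0 := by
              rw [Nat.floor_eq_zero, div_lt_one hα]; exact hgt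
            omega

/-! ## The refinement theorems -/

/-- **Positive unimodular refinement around an irrational ray (positive quadrant).**  `ω = (ω₁, ω₂)`, `ω₁, ω₂ > 0`, `ℚ`-independent;
`F` finite set of integral forms positive at `ω`.  Then `ℤ²` has a basis `(a, c), (b, d)` with non-negative entries, `ad − bc = ±1`,
`ω = α (a, c) + β (b, d)` with `α, β > 0`, and every `f ∈ F` positive on both basis vectors. -/
theorem exists_unimodular_positive_refinement (ω₁ ω₂ : ℝ) (hω₁ : 0 < ω₁) (hω₂ : 0 < ω₂)
    (hind : ∀ u v : ℤ, (u : ℝ) * ω₁ + v * ω₂ = 0 → u = 0 ∧ v = 0)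
    (F : Finset (ℤ × ℤ)) (hF : ∀ f ∈ F, 0 < (f.1 : ℝ) * ω₁ + f.2 * ω₂) :
    ∃ (a b c d : ℤ) (α β : ℝ), 0 < α ∧ 0 < β ∧ 0 ≤ a ∧ 0 ≤ b ∧ 0 ≤ c ∧ 0 ≤ d ∧
      (a * d - b * c = 1 ∨ a * d - b * c = -1) ∧ ω₁ = a * α + b * β ∧ ω₂ = c * α + d * β ∧
      ∀ f ∈ F, 0 < f.1 * a + f.2 * c ∧ 0 < f.1 * b + f.2 * d :=
  refine_aux ω₁ ω₂ hind F hF _ _ ω₁ ω₂ 1 0 0 1 hω₁ hω₂ (by norm_num) le_rfl le_rfl (by norm_num) (by norm_num)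
    (by push_cast; ring) (by push_cast; ring) le_rfl le_rfl

/-- **Positive unimodular refinement around an irrational ray (any quadrant).**  Same, for `ω` with `ℚ`-independent coordinates of any
signs (the basis vectors then have entries of the corresponding signs; only `det = ±1` is recorded). -/
theorem exists_unimodular_positive_refinement' (ω₁ ω₂ : ℝ)
    (hind : ∀ u v : ℤ, (u : ℝ) * ω₁ + v * ω₂ = 0 → u = 0 ∧ v = 0)
    (F : Finset (ℤ × ℤ)) (hF : ∀ f ∈ F, 0 < (f.1 : ℝ) * ω₁ + f.2 * ω₂) :
    ∃ (a b c d : ℤ) (α β : ℝ), 0 < α ∧ 0 < β ∧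
      (a * d - b * c = 1 ∨ a * d - b * c = -1) ∧ ω₁ = a * α + b * β ∧ ω₂ = c * α + d * β ∧
      ∀ f ∈ F, 0 < f.1 * a + f.2 * c ∧ 0 < f.1 * b + f.2 * d := by
  classical
  -- signs
  have hω₁ : ω₁ ≠ 0 := by
    intro h; have := (hind 1 0 (by rw [h]; simp)).1; exact one_ne_zero this
  have hω₂ : ω₂ ≠ 0 := by
    intro h; have := (hind 0 1 (by rw [h]; simp)).2; exact one_ne_zero this
  obtain ⟨s₁, hs₁, hs₁ω⟩ : ∃ s₁ : ℤ, s₁ * s₁ = 1 ∧ 0 < (s₁ : ℝ) * ω₁ := by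
    rcases lt_or_gt_of_ne hω₁ with h | h
    · exact ⟨-1, by norm_num, by push_cast; nlinarith⟩
    · exact ⟨1, by norm_num, by push_cast; nlinarith⟩
  obtain ⟨s₂, hs₂, hs₂ω⟩ : ∃ s₂ : ℤ, s₂ * s₂ = 1 ∧ 0 < (s₂ : ℝ) * ω₂ := by
    rcases lt_or_gt_of_ne hω₂ with h | h
    · exact ⟨-1, by norm_num, by push_cast; nlinarith⟩
    · exact ⟨1, by norm_num, by push_cast; nlinarith⟩
  have hs₁r : (s₁ : ℝ) * s₁ = 1 := by exact_mod_cast hs₁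
  have hs₂r : (s₂ : ℝ) * s₂ = 1 := by exact_mod_cast hs₂
  -- twisted data
  have hind' : ∀ u v : ℤ, (u : ℝ) * (s₁ * ω₁) + v * (s₂ * ω₂) = 0 → u = 0 ∧ v = 0 := by
    intro u v h
    have h' : ((u * s₁ : ℤ) : ℝ) * ω₁ + ((v * s₂ : ℤ) : ℝ) * ω₂ = 0 := by push_cast; linarith [h]
    obtain ⟨h1, h2⟩ := hind _ _ h'
    constructor
    · have := congrArg (· * s₁) h1; simp only [mul_assoc, hs₁, mul_one, zero_mul] at this; exact this
    · have := congrArg (· * s₂) h2; simp only [mul_assoc, hs₂, mul_one, zero_mul] at this; exact this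
  let g : ℤ × ℤ → ℤ × ℤ := fun f => (f.1 * s₁, f.2 * s₂)
  have hF' : ∀ f' ∈ F.image g, 0 < (f'.1 : ℝ) * (s₁ * ω₁) + f'.2 * (s₂ * ω₂) := by
    intro f' hf'
    obtain ⟨f, hf, rfl⟩ := Finset.mem_image.mp hf'
    have := hF f hf
    simp only [g]; push_cast
    have e1 : (f.1 : ℝ) * s₁ * (s₁ * ω₁) = f.1 * ω₁ := by
      rw [mul_assoc, ← mul_assoc (s₁ : ℝ), hs₁r, one_mul]
    have e2 : (f.2 : ℝ) * s₂ * (s₂ * ω₂) = f.2 * ω₂ := by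
      rw [mul_assoc, ← mul_assoc (s₂ : ℝ), hs₂r, one_mul]
    rw [e1, e2]; exact this
  obtain ⟨a, b, c, d, α, β, hα, hβ, -, -, -, -, hdet, h1, h2, hgood⟩ :=
    exists_unimodular_positive_refinement (s₁ * ω₁) (s₂ * ω₂) hs₁ω hs₂ω hind' (F.image g) hF'
  refine ⟨s₁ * a, s₁ * b, s₂ * c, s₂ * d, α, β, hα, hβ, ?_, ?_, ?_, ?_⟩
  · have e : s₁ * a * (s₂ * d) - s₁ * b * (s₂ * c) = (s₁ * s₂) * (a * d - b * c) := by ring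
    have h1' : s₁ = 1 ∨ s₁ = -1 := Int.eq_one_or_neg_one_of_mul_eq_one hs₁
    have h2' : s₂ = 1 ∨ s₂ = -1 := Int.eq_one_or_neg_one_of_mul_eq_one hs₂
    rw [e]
    rcases h1' with rfl | rfl <;> rcases h2' with rfl | rfl <;> rcases hdet with h | h <;> simp [h]
  · calc ω₁ = (s₁ : ℝ) * (s₁ * ω₁) := by rw [← mul_assoc, hs₁r, one_mul]
      _ = _ := by rw [h1]; push_cast; ring
  · calc ω₂ = (s₂ : ℝ) * (s₂ * ω₂) := by rw [← mul_assoc, hs₂r, one_mul]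
      _ = _ := by rw [h2]; push_cast; ring
  · intro f hf
    have := hgood (g f) (Finset.mem_image_of_mem g hf)
    simp only [g] at this
    constructor <;> nlinarith [this.1, this.2]

end Summit.ResolutionOfSingularities.ResolutionOfSingularities.Theorems.RadicialJung.CleanModels.Lens5.UnimodularRefinement

end
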